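import Summits.ResolutionOfSingularities.ResolutionOfSingularities.Theorems.FrobeniusClosingPatchingRelPerfectDepthTaylorFlagComap
import Mathlib.RingTheory.LocalRing.MaximalIdeal.Basic
import HarnessLib

/-!
# Crux `PatchingRelPerfect` (stmt-ResolutionOfSingularities-16161), chain W5.2 — depth-two programme beyond the graded case,
# F6 / T6-H RING CORE: at a point where the level-one coefficient ideal is the unit ideal, the residual ideal contains a
# REGULAR PARAMETER (the host is a regular hypersurface, possibly tangent to `E`) (lead prover, gen 4)

[OURS · L1 W5.2 · lead] Replaces the role of NO printed item; NOT a statement of the manuscript under review.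

res-L1-w52-plan-1's F6 DESIGN MEMO (c3041ebc) §1 KEY OBSERVATION / §3 T6-H: for a depth-two member `K = 𝓗 ⊔ 𝓘_E²` with coefficient flag
`R₂ = coeffFlag 0`, `R₁ = coeffFlag 1`, at a point `x ∈ E ∩ cosupp K` with `ord_x (R₂ + R₁²) ≤ 1` the host `𝓗_x` is generated by a regular
parameter: either `ord_x R₂ = 1`, or `(R₁)_x = ⊤`, i.e. some `p ∈ ψ⁻¹K` has a UNIT first Taylor coefficient, and then `ψ p = φr(p₀) + t·(unit) + t²·(…)`
is not in `𝔪_x²` because `t ∉ 𝔪_x²`. This file is the local-ring core of that observation, over the retraction-pair-of-rings language of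
G2′ (`…DepthTaylorFlagComap`, p513427): `φk : R → A`, `φr : A → R`, `φk ∘ φr = id`, `φk t = 0`, `ψ = eval₂RingHom φr t`, `R`, `A` LOCAL.

* `isLocalHom_of_retraction`, `map_maximalIdeal_le_of_retraction` — `φr` and `φk` are local;
* **`eval₂_not_mem_sq_of_isUnit_coeff_one`** — `IsUnit (p.coeff 1)`, `t ∉ 𝔪_R²` ⇒ `ψ p ∉ 𝔪_R²`;
* `not_mem_sq_of_map_not_mem_sq` — the other case: `φk h ∉ 𝔪_A²` ⇒ `h ∉ 𝔪_R²`;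
* `generator_not_mem_sq_of_mem_sup` — if `K = (F) ⊔ L` with `L ≤ 𝔪_R²` (e.g. `L = 𝓘_E²`) contains an element outside `𝔪_R²`, then `F ∉ 𝔪_R²`
  (the host generator is a regular parameter).

Fact-free; AI-written, weaker than expert review. The scheme-level T6-H (stalks of `coeffFlag`, `idealOrder`) is typed by plan-1 and proved over this.

References: H. Kawanoue, K. Matsuki, Adv. Stud. Pure Math. 70 (2016), §2 [KawanoueMatsuki2016] (coefficient ideals); folklore local algebra.
-/

-- `Summit.<Summit>.<Sub>.Theorems` with `Sub = Summit` (single-conjunct summit, D-0017)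
set_option linter.dupNamespace false

noncomputable section

open Polynomial IsLocalRing

namespace Summit.ResolutionOfSingularities.ResolutionOfSingularities.Theorems

universe u

namespace DepthGraded.Taylor

section HostRegular

variable {R A : Type u} [CommRing R] [IsLocalRing R] [CommRing A] [IsLocalRing A]
  (φk : R →+* A) (φr : A →+* R) (t : R) (hkr : ∀ a, φk (φr a) = a) (hkt : φk t = 0)

include hkr in
omit [IsLocalRing R] [IsLocalRing A] in
/-- For a retraction pair of rings, the section `φr` is a local homomorphism (`φr a` a unit ⇒ `a = φk (φr a)` a unit). [folklore] -/
theorem isLocalHom_of_retraction : IsLocalHom φr :=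
  ⟨fun a ha => by simpa [hkr a] using ha.map φk⟩

include hkt in
/-- The kernel generator `t` is a non-unit (`A` is nontrivial). [folklore] -/
theorem generator_mem_maximalIdeal : t ∈ maximalIdeal R := by
  rw [mem_maximalIdeal, mem_nonunits_iff]
  intro ht
  have h1 : IsUnit (φk t) := ht.map φk
  rw [hkt] at h1
  exact not_isUnit_zero h1

include hkt in
/-- For a retraction pair of rings with `φk t = 0` and `x − φr(φk x) ∈ (t)` for all `x` (e.g. `ker φk = (t)`), `φk` maps the maximal ideal
into the maximal ideal (`x = φr(φk x) + (x − φr(φk x))` = unit + non-unit if `φk x` is a unit). [folklore] -/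
theorem map_maximalIdeal_le_of_retraction (hsec : ∀ x : R, x - φr (φk x) ∈ Ideal.span {t}) :
    (maximalIdeal R).map φk ≤ maximalIdeal A := by
  rw [Ideal.map_le_iff_le_comap]
  intro x hx
  rw [Ideal.mem_comap, mem_maximalIdeal, mem_nonunits_iff]
  intro hu
  have h1 : IsUnit (φr (φk x)) := hu.map φr
  have h2 : x - φr (φk x) ∈ maximalIdeal R :=
    (Ideal.span_le.mpr (Set.singleton_subset_iff.mpr (generator_mem_maximalIdeal φk t hkt))) (hsec x)
  have h3 : φr (φk x) ∈ maximalIdeal R := by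
    have := Submodule.sub_mem _ hx h2
    rwa [sub_sub_cancel] at this
  exact (mem_nonunits_iff.mp ((IsLocalRing.mem_maximalIdeal _).mp h3)) h1

include hkr in
omit [IsLocalRing R] [IsLocalRing A] in
/-- With `ker φk = (t)`: `x − φr(φk x) ∈ (t)`. [folklore] -/
theorem sub_section_mem_span (hker : RingHom.ker φk = Ideal.span {t}) (x : R) : x - φr (φk x) ∈ Ideal.span {t} := by
  rw [← hker, RingHom.mem_ker, map_sub, hkr, sub_self]

include hkr hkt in
/-- [OURS · L1 W5.2 · lead] **T6-H ring core.** If `p ∈ A[t]` has a UNIT first Taylor coefficient and `t ∉ 𝔪_R²`, then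
`ψ p = φr(p₀) + t·φr(p₁) + t²·ψ(p″) ∉ 𝔪_R²` (if it were, `φk` gives `p₀ ∈ 𝔪_A²`, so `φr p₀ ∈ 𝔪_R²`, so `t·unit ∈ 𝔪_R²`, so `t ∈ 𝔪_R²`).
With `(R₁)_x = ⊤ ⟺ ∃ p ∈ ψ⁻¹K, p₁ unit` this is «the residual ideal contains a regular parameter». [folklore] -/
theorem eval₂_not_mem_sq_of_isUnit_coeff_one (hsec : ∀ x : R, x - φr (φk x) ∈ Ideal.span {t})
    (ht : t ∉ (maximalIdeal R) ^ 2) (p : A[X]) (hp : IsUnit (p.coeff 1)) :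
    Polynomial.eval₂RingHom φr t p ∉ (maximalIdeal R) ^ 2 := by
  haveI := isLocalHom_of_retraction φk φr hkr
  intro hmem
  have hφk : (maximalIdeal R).map φk ≤ maximalIdeal A := map_maximalIdeal_le_of_retraction φk φr t hkt hsec
  have hφr : (maximalIdeal A).map φr ≤ maximalIdeal R :=
    ((IsLocalRing.local_hom_TFAE φr).out 0 2).mp ‹IsLocalHom φr›
  -- Taylor decomposition `p = C p₀ + t·(C p₁ + t·p″)`
  have hdec : p = Polynomial.C (p.coeff 0) + X * (Polynomial.C (p.coeff 1) + X * Polynomial.divX (Polynomial.divX p)) := by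
    conv_lhs => rw [← Polynomial.X_mul_divX_add p]
    conv_lhs => arg 1; arg 2; rw [← Polynomial.X_mul_divX_add (Polynomial.divX p), Polynomial.coeff_divX]
    ring
  have hψ : Polynomial.eval₂RingHom φr t p = φr (p.coeff 0) + t * φr (p.coeff 1) +
      t ^ 2 * Polynomial.eval₂RingHom φr t (Polynomial.divX (Polynomial.divX p)) := by
    conv_lhs => rw [hdec]
    simp only [map_add, map_mul, Polynomial.coe_eval₂RingHom, Polynomial.eval₂_C, Polynomial.eval₂_X]
    ring
  -- `p₀ = φk (ψ p) ∈ 𝔪_A²`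
  have h0 : p.coeff 0 ∈ (maximalIdeal A) ^ 2 := by
    rw [← apply_eval₂RingHom_eq_coeff_zero φk φr t hkr hkt p]
    have := Ideal.mem_map_of_mem φk hmem
    rw [Ideal.map_pow] at this
    exact Ideal.pow_right_mono hφk 2 this
  have h0' : φr (p.coeff 0) ∈ (maximalIdeal R) ^ 2 := by
    have := Ideal.mem_map_of_mem φr h0
    rw [Ideal.map_pow] at this
    exact Ideal.pow_right_mono hφr 2 this
  have ht𝔪 : t ∈ maximalIdeal R := generator_mem_maximalIdeal φk t hkt
  have h2 : t ^ 2 * Polynomial.eval₂RingHom φr t (Polynomial.divX (Polynomial.divX p)) ∈ (maximalIdeal R) ^ 2 :=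
    Ideal.mul_mem_right _ _ (Ideal.pow_mem_pow ht𝔪 2)
  have h1 : t * φr (p.coeff 1) ∈ (maximalIdeal R) ^ 2 := by
    have : t * φr (p.coeff 1) = Polynomial.eval₂RingHom φr t p - φr (p.coeff 0) -
        t ^ 2 * Polynomial.eval₂RingHom φr t (Polynomial.divX (Polynomial.divX p)) := by rw [hψ]; ring
    rw [this]
    exact Submodule.sub_mem _ (Submodule.sub_mem _ hmem h0') h2
  obtain ⟨u, hu⟩ := hp.map φr
  apply ht
  have : t = t * φr (p.coeff 1) * ↑u⁻¹ := by rw [← hu, mul_assoc, Units.mul_inv, mul_one]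
  rw [this]
  exact Ideal.mul_mem_right _ _ h1

/-- The other case of T6-H: if `φk h ∉ 𝔪_A²` (the restriction of `h ∈ K` to `W` has order one) then `h ∉ 𝔪_R²`, provided `φk` is local.
[folklore] -/
theorem not_mem_sq_of_map_not_mem_sq (hφk : (maximalIdeal R).map φk ≤ maximalIdeal A) {h : R}
    (hh : φk h ∉ (maximalIdeal A) ^ 2) : h ∉ (maximalIdeal R) ^ 2 := by
  intro hmem
  apply hh
  have := Ideal.mem_map_of_mem φk hmem
  rw [Ideal.map_pow] at this
  exact Ideal.pow_right_mono hφk 2 this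

omit [IsLocalRing A] in
/-- **The host generator is a regular parameter**: if `K = (F) ⊔ L` with `L ≤ 𝔪_R²` (e.g. `L = 𝓘_E²`) contains an element outside `𝔪_R²`,
then `F ∉ 𝔪_R²`. [folklore] -/
theorem generator_not_mem_sq_of_mem_sup {F h : R} {L : Ideal R} (hL : L ≤ (maximalIdeal R) ^ 2)
    (hh : h ∈ Ideal.span {F} ⊔ L) (hh2 : h ∉ (maximalIdeal R) ^ 2) : F ∉ (maximalIdeal R) ^ 2 := by
  intro hF
  apply hh2
  obtain ⟨a, ha, l, hl, rfl⟩ := Submodule.mem_sup.mp hh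
  obtain ⟨c, rfl⟩ := Ideal.mem_span_singleton'.mp ha
  exact Submodule.add_mem _ (Ideal.mul_mem_left _ _ hF) (hL hl)

end HostRegular

end DepthGraded.Taylor

end Summit.ResolutionOfSingularities.ResolutionOfSingularities.Theorems

end
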